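import Mathlib
import Summits.NavierStokesRegularity.NavierStokesRegularity.Theorems.EulerZoomLiouvillePowerGaugeEulerLiouvilleSelfSimilarVorticityTransport
import Literature.Analysis.FluidPDE.AxisymNoSwirlVorticity
import Literature.Analysis.FluidPDE.AxisymVorticityAlgebra
import Literature.Analysis.FluidPDE.AxisymHouLiVariables
import Literature.Analysis.FluidPDE.AxisymmetricVorticityTransport
import Literature.Analysis.FluidPDE.AxisymOmegaThetaEnergy
import HarnessLib.Audit

/-!
# Crux E `EulerZoomLiouville.PowerGaugeEulerLiouville` — the needle stratum: the CASIMIR CLOCK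
# of an axisymmetric swirl-free self-similar profile, in Cauchy form

Route №10 `EulerZoomLiouville` (NavierStokesRegularity), crux E = stmt-NavierStokesRegularity-19832,
registered residue `stub_selfSimilarC2Needle` (skeleton of record `Cruxes/PowerGaugeEulerLiouville/
Lines/birth.lean`), memo ROUND-37 of the cell `ns-regularity-ideate` (nsreg-p2), step **(C)** «the
Casimir clock».  PROFILE-LEVEL toolkit, no measure theory.

Setting: a `C²` stationary self-similar Euler profile `(V, P)` centred at `0`
(`IsSelfSimilarEulerProfile γ 0 V P`, CIV 2026 (3.3)) which is AXISYMMETRIC about the `x 2`-axis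
(`IsAxisymmetric V`) and SWIRL-FREE (`HasNoSwirl V`); transport field `W = γ y + V`
(`selfSimilarTransport γ 0 V`), vorticity `Ω = curl V`, infinitesimal rotation
`J y = (−y₁, y₀, 0) = r⊥ e_θ` (`rotGen`).  For such a field `Ω = ξ · J` with `ξ = ω_θ / r⊥`
continuous across the axis (tree `curl_eq_hadamardQuotFst_smul_rotGen`, KNSS 2009 Remark 5.1).

* `isAxisymmetric_selfSimilarTransport` — `W` is axisymmetric when `V` is.
* `hasDerivAt_smul_rotGen_comp` — **the comparison solution**: along ANY solution of `Y' = σ W(Y)`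
  the field `w(t) = ξ₀ • J(Y(t))` solves the linear variational equation `w' = σ DW(Y(t)) w`
  (because `DW(y)[J y] = J(W y)`, infinitesimal axisymmetry, tree `IsAxisymmetric.fderiv_rotGen`).
* `curl_comp_eq_exp_smul_rotGen_of_sigma` — **THE CLOCK.**  The weighted vorticity
  `u(t) = e^{σ(1+γ)t} Ω(Y(t))` solves the SAME linear equation (tree
  `NodalFiniteness.hasDerivAt_weightedCurl_comp`, the quantitative Cauchy formula (3.22) as an ODE),
  and `u(0) = w(0)` once `Ω(Y 0) = ξ₀ • J(Y 0)`; uniqueness for Lipschitz linear ODEs on `[0, T]`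
  (Mathlib `ODE_solution_unique_of_mem_Icc_right`, Lipschitz constant `sup_{[0,T]} ‖DW(Y t)‖` from
  compactness — NO global bound on `∇V` is assumed, the profile may be unbounded) gives
  `Ω(Y t) = ξ₀ e^{−σ(1+γ)t} • J(Y t)` on `[0, T]`.
* `curl_comp_eq_exp_smul_rotGen` (`σ = −1`, BACKWARD self-similar time — the direction of the
  needle race): `Ω(Y t) = ξ₀ e^{(1+γ)t} • J(Y t)`; norm forms `norm_curl_comp_eq`
  (`‖Ω(Y t)‖ = |ξ₀| e^{(1+γ)t} r⊥(Y t)`), the `ξ₀`-free cross form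
  `norm_curl_comp_mul_cylRadius_eq` (`‖Ω(Y t)‖ · r⊥(Y 0) = e^{(1+γ)t} ‖Ω(Y 0)‖ · r⊥(Y t)`) and the
  squared form `norm_curl_comp_sq_eq` consumed by the bathtub step of ROUND-37 (C)
  (`∫_{Φ_T(S)} ‖Ω‖² ≥ ξ₀² e^{2(1+γ)T} ∫_{Φ_T(S)} r⊥²`, tree `NeedleAxisymBand.sq_volume_le_integral_cylRadius_sq`).
* `curl_comp_eq_exp_neg_smul_rotGen` (`σ = 1`, forward): `Ω(Y t) = ξ₀ e^{−(1+γ)t} • J(Y t)`.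
* **NO VORTICAL RECURRENCE** (`curl_eq_zero_of_recurrent_backwardOrbit`, qualitative, no budgets):
  for `1 + γ > 0`, a backward orbit `Y' = −W(Y)` (`t ≥ 0`) that returns to a fixed ball at
  arbitrarily late times satisfies `Ω(Y 0) = 0` — `ξ = ω_θ/r⊥` is continuous (KNSS Remark 5.1, tree
  `contDiff_hadamardQuotFst_curl`) hence bounded on the ball, the orbit never reaches the axis in
  finite time (`cylRadius_pos_of_backwardOrbit`: `φ = r⊥(Y)²` has `φ' ≥ −4Kφ` by the horizontal
  Lipschitz bound at the axis `abs_horizontal_le_mul_cylRadius`), and the clock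
  `|ξ(Y t)| = |ξ(Y 0)| e^{(1+γ)t}` forbids late returns unless `ξ(Y 0) = 0`.  Corollaries: bounded
  backward orbits, stagnation points (`curl_eq_zero_of_stagnation`) and compact backward-invariant
  sets of `W` are irrotational (`curl_eq_zero_of_bounded_backwardOrbit`); a backward orbit through a
  vortical point ESCAPES, `‖Y t‖ → ∞` (`tendsto_norm_atTop_of_curl_ne_zero`).  For the needle
  stratum (D2 of the LEAD's residue memo: axisymmetric swirl-free, unbounded) this says: the support
  of `Ω` is carried entirely by backward-escaping labels — the slow/recurrent part of the
  self-similar Lagrangian dynamics is irrotational, and the race of ROUND-37 is only about HOW FAST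
  vortical labels must escape.

Reading.  `ξ = ω_θ / r⊥` is the classical material invariant of axisymmetric swirl-free Euler
flow (`D_t (ω_θ/r) = 0`; tree `timeDerivWithin_angVortQuot_eq_neg` for smooth time-dependent
flows); in self-similar variables with `Ω = (T* − t) ω` it becomes the exponential CLOCK
`ξ(Y(s)) = ξ(Y(0)) e^{(1+γ)s}` along backward similarity trajectories.  The present derivation needs
only `V ∈ C²` (the class of THE ONE STATEMENT) — no `C³` Hou–Li quotient calculus and no Eulerian
identity `W·∇ξ = −(1+γ)ξ`: the clock is read off the Cauchy formula by ODE uniqueness.  The orbit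
hypothesis is pointwise on `[0, T]` (`HasDerivAt` at each `t ∈ [0, T]`), so it applies verbatim to
orbits of a cut-off field on the time interval during which they stay where the cut-off is `1`.

Every theorem of this file is PROVED (no `sorry`, standard axioms).

## References

* P. Constantin, M. Ignatova, V. Vicol, *On putative self-similarity for incompressible 3D Euler*,
  arXiv:2602.17570 (2026), §3.4.1 eq. (3.22) (Cauchy formula in self-similar variables).
* G. Koch, N. Nadirashvili, G. Seregin, V. Šverák, *Liouville theorems for the Navier–Stokes
  equations and applications*, Acta Math. 203 (2009), §5, Remark 5.1 (`ω = ω_θ e_θ`, `ω_θ/r`).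
* A. Majda, A. Bertozzi, *Vorticity and Incompressible Flow*, CUP 2002, §2.3.3
  (`D_t(ω_θ/r) = 0` for axisymmetric flows without swirl).
-/

set_option linter.dupNamespace false

open Set Filter Topology
open Literature.Analysis Literature.Analysis.FluidPDE
open Summit.NavierStokesRegularity.NavierStokesRegularity.Theorems.PowerGaugeEulerLiouville

namespace Summit.NavierStokesRegularity.NavierStokesRegularity.Theorems.PowerGaugeEulerLiouville.NeedleCasimirClock

variable {γ : ℝ} {V : (EuclideanSpace ℝ (Fin 3)) → (EuclideanSpace ℝ (Fin 3))}
  {P : (EuclideanSpace ℝ (Fin 3)) → ℝ}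

/-! ### Axisymmetry of the transport field; the infinitesimal rotation along curves -/

/-- `R_θ (a • x + y) = a • R_θ x + R_θ y` (the rotation is linear). [folklore] -/
theorem rotZ_smul_add (θ a : ℝ) (x y : EuclideanSpace ℝ (Fin 3)) :
    rotZ θ (a • x + y) = a • rotZ θ x + rotZ θ y := by
  have h1 := map_add (rotZL θ) (a • x) y
  have h2 := map_smul (rotZL θ) a x
  simp only [rotZL_apply] at h1 h2
  rw [h1, h2]

/-- **The transport field `W = γ y + V` of an axisymmetric profile is axisymmetric.** [folklore] -/
theorem isAxisymmetric_selfSimilarTransport (hax : IsAxisymmetric V) (γ : ℝ) :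
    IsAxisymmetric (selfSimilarTransport γ 0 V) := by
  intro θ x
  simp only [selfSimilarTransport_apply, sub_zero]
  rw [hax θ x, rotZ_smul_add]

/-- `W` is differentiable for a profile. [folklore] -/
theorem differentiable_selfSimilarTransport (hV : Differentiable ℝ V) (γ : ℝ)
    (c : EuclideanSpace ℝ (Fin 3)) : Differentiable ℝ (selfSimilarTransport γ c V) :=
  fun y => (hasFDerivAt_selfSimilarTransport (γ := γ) (c := c) hV y).differentiableAt

/-- `d/dt J(Y t) = J(Y' t)` (the generator is linear). [folklore] -/
theorem hasDerivAt_rotGen_comp {Y : ℝ → EuclideanSpace ℝ (Fin 3)} {Y' : EuclideanSpace ℝ (Fin 3)}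
    {t : ℝ} (hY : HasDerivAt Y Y' t) :
    HasDerivAt (fun s => rotGen (Y s)) (rotGen Y') t := by
  have h := (hasFDerivAt_rotGen (Y t)).comp_hasDerivAt t hY
  simpa [Function.comp_def] using h

-- `‖J y‖ = r⊥(y)` is the tree's `Literature.Analysis.FluidPDE.norm_rotGen_eq_cylRadius'` (…AxisymOmegaThetaEnergy); the plate's copy
-- `norm_rotGen_eq_cylRadius` was removed at the gate (dedup.landed) by the firing seat ns-ezl-w7 g0 — the only edit to nsreg-p2's text.

/-- **The comparison solution.** Along a solution of `Y' = σ W(Y)` with `W` axisymmetric and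
differentiable, `w(t) = ξ₀ • J(Y t)` solves `w' = (σ DW(Y t)) w` — since `DW(y)[J y] = J(W y)`
(infinitesimal axisymmetry). [folklore] -/
theorem hasDerivAt_smul_rotGen_comp {W : (EuclideanSpace ℝ (Fin 3)) → (EuclideanSpace ℝ (Fin 3))}
    (hW : IsAxisymmetric W) (hWd : Differentiable ℝ W) {σ : ℝ}
    {Y : ℝ → EuclideanSpace ℝ (Fin 3)} {t : ℝ} (hY : HasDerivAt Y (σ • W (Y t)) t) (ξ₀ : ℝ) :
    HasDerivAt (fun s => ξ₀ • rotGen (Y s))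
      ((σ • fderiv ℝ W (Y t)) (ξ₀ • rotGen (Y t))) t := by
  have h1 := (hasDerivAt_rotGen_comp hY).const_smul ξ₀
  refine h1.congr_deriv ?_
  rw [rotGen_smul, FunLike.coe_smul, Pi.smul_apply, map_smul, hW.fderiv_rotGen (hWd _),
    smul_comm]

/-! ### The clock -/

/-- **THE CASIMIR CLOCK IN CAUCHY FORM (general time direction `σ`).**  For a `C²` axisymmetric
swirl-free self-similar Euler profile and a solution `Y` of `Y' = σ W(Y)` on `[0, T]` with
`Ω(Y 0) = ξ₀ • J(Y 0)`:  `Ω(Y t) = ξ₀ e^{−σ(1+γ)t} • J(Y t)` for `t ∈ [0, T]`.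
[cite: ConstantinIgnatovaVicol2026Putative, §3.4.1 eq. (3.22)] -/
theorem curl_comp_eq_exp_smul_rotGen_of_sigma (h : IsSelfSimilarEulerProfile γ 0 V P)
    (hax : IsAxisymmetric V) (hsw : HasNoSwirl V) {σ T : ℝ} (hT : 0 ≤ T)
    {Y : ℝ → EuclideanSpace ℝ (Fin 3)}
    (hY : ∀ t ∈ Icc 0 T, HasDerivAt Y (σ • selfSimilarTransport γ 0 V (Y t)) t)
    {ξ₀ : ℝ} (h0 : curl V (Y 0) = ξ₀ • rotGen (Y 0)) :
    ∀ t ∈ Icc 0 T, curl V (Y t) = (ξ₀ * Real.exp (-(σ * (1 + γ) * t))) • rotGen (Y t) := by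
  have _hsw := hsw
  set W := selfSimilarTransport γ 0 V with hWdef
  have hWax : IsAxisymmetric W := isAxisymmetric_selfSimilarTransport hax γ
  have hWd : Differentiable ℝ W := differentiable_selfSimilarTransport h.differentiable_velocity γ 0
  -- the linear equation `x' = A t x`, `A t = σ DW(Y t)`
  set A : ℝ → (EuclideanSpace ℝ (Fin 3)) →L[ℝ] (EuclideanSpace ℝ (Fin 3)) :=
    fun t => σ • fderiv ℝ W (Y t) with hA
  set u : ℝ → EuclideanSpace ℝ (Fin 3) :=
    fun s => Real.exp (σ * (1 + γ) * s) • curl V (Y s) with hu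
  set w : ℝ → EuclideanSpace ℝ (Fin 3) := fun s => ξ₀ • rotGen (Y s) with hw
  have hu' : ∀ t ∈ Icc 0 T, HasDerivAt u (A t (u t)) t := fun t ht =>
    NodalFiniteness.hasDerivAt_weightedCurl_comp h (hY t ht)
  have hw' : ∀ t ∈ Icc 0 T, HasDerivAt w (A t (w t)) t := fun t ht =>
    hasDerivAt_smul_rotGen_comp hWax hWd (hY t ht) ξ₀
  -- a uniform bound on `‖DW(Y t)‖`, `t ∈ [0, T]`, by compactness
  have hYc : ContinuousOn Y (Icc 0 T) := fun t ht => (hY t ht).continuousAt.continuousWithinAt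
  obtain ⟨K, hK⟩ : ∃ K, ∀ t ∈ Icc 0 T, ‖fderiv ℝ W (Y t)‖ ≤ K := by
    have hc : ContinuousOn (fun t => fderiv ℝ W (Y t)) (Icc 0 T) :=
      (NodalFiniteness.continuous_fderiv_transport h).comp_continuousOn hYc
    obtain ⟨K, hK⟩ := (isCompact_Icc.image_of_continuousOn hc).isBounded.exists_norm_le
    exact ⟨K, fun t ht => hK _ (mem_image_of_mem _ ht)⟩
  have hK0 : 0 ≤ K := (norm_nonneg _).trans (hK 0 (left_mem_Icc.2 hT))
  have hLip : ∀ t ∈ Ico 0 T, LipschitzOnWith (Real.toNNReal (|σ| * K))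
      (fun x : EuclideanSpace ℝ (Fin 3) => A t x) univ := by
    intro t ht
    refine ((A t).lipschitz.weaken ?_).lipschitzOnWith
    rw [← NNReal.coe_le_coe, coe_nnnorm, Real.coe_toNNReal _ (mul_nonneg (abs_nonneg σ) hK0)]
    calc ‖A t‖ = |σ| * ‖fderiv ℝ W (Y t)‖ := by
          show ‖σ • fderiv ℝ W (Y t)‖ = _
          rw [norm_smul, Real.norm_eq_abs]
      _ ≤ |σ| * K := mul_le_mul_of_nonneg_left (hK t (Ico_subset_Icc_self ht)) (abs_nonneg σ)
  have hEq : EqOn u w (Icc 0 T) :=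
    ODE_solution_unique_of_mem_Icc_right (v := fun t x => A t x) (s := fun _ => univ) hLip
      (fun t ht => (hu' t ht).continuousAt.continuousWithinAt)
      (fun t ht => (hu' t (Ico_subset_Icc_self ht)).hasDerivWithinAt) (fun _ _ => mem_univ _)
      (fun t ht => (hw' t ht).continuousAt.continuousWithinAt)
      (fun t ht => (hw' t (Ico_subset_Icc_self ht)).hasDerivWithinAt) (fun _ _ => mem_univ _)
      (by simp [hu, hw, h0])
  intro t ht
  have e : Real.exp (σ * (1 + γ) * t) • curl V (Y t) = ξ₀ • rotGen (Y t) := hEq ht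
  have hone : Real.exp (-(σ * (1 + γ) * t)) * Real.exp (σ * (1 + γ) * t) = 1 := by
    rw [← Real.exp_add, show -(σ * (1 + γ) * t) + σ * (1 + γ) * t = 0 by ring, Real.exp_zero]
  calc curl V (Y t)
        = Real.exp (-(σ * (1 + γ) * t)) • (Real.exp (σ * (1 + γ) * t) • curl V (Y t)) := by
          rw [smul_smul, hone, one_smul]
    _ = Real.exp (-(σ * (1 + γ) * t)) • (ξ₀ • rotGen (Y t)) := by rw [e]
    _ = (ξ₀ * Real.exp (-(σ * (1 + γ) * t))) • rotGen (Y t) := by rw [smul_smul, mul_comm]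

/-- **THE CASIMIR CLOCK, backward self-similar time** (`σ = −1`, the direction of the needle race of
ROUND-37): along a backward orbit `Y' = −W(Y)` on `[0, T]` with `Ω(Y 0) = ξ₀ • J(Y 0)`,
`Ω(Y t) = ξ₀ e^{(1+γ)t} • J(Y t)`. [cite: ConstantinIgnatovaVicol2026Putative, §3.4.1 eq. (3.22)] -/
theorem curl_comp_eq_exp_smul_rotGen (h : IsSelfSimilarEulerProfile γ 0 V P)
    (hax : IsAxisymmetric V) (hsw : HasNoSwirl V) {T : ℝ} (hT : 0 ≤ T)
    {Y : ℝ → EuclideanSpace ℝ (Fin 3)}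
    (hY : ∀ t ∈ Icc 0 T, HasDerivAt Y ((-1 : ℝ) • selfSimilarTransport γ 0 V (Y t)) t)
    {ξ₀ : ℝ} (h0 : curl V (Y 0) = ξ₀ • rotGen (Y 0)) :
    ∀ t ∈ Icc 0 T, curl V (Y t) = (ξ₀ * Real.exp ((1 + γ) * t)) • rotGen (Y t) := by
  intro t ht
  rw [curl_comp_eq_exp_smul_rotGen_of_sigma h hax hsw hT hY h0 t ht,
    show -((-1 : ℝ) * (1 + γ) * t) = (1 + γ) * t by ring]

/-- The clock, forward self-similar time (`σ = 1`): `Ω(Y t) = ξ₀ e^{−(1+γ)t} • J(Y t)`.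
[cite: ConstantinIgnatovaVicol2026Putative, §3.4.1 eq. (3.22)] -/
theorem curl_comp_eq_exp_neg_smul_rotGen (h : IsSelfSimilarEulerProfile γ 0 V P)
    (hax : IsAxisymmetric V) (hsw : HasNoSwirl V) {T : ℝ} (hT : 0 ≤ T)
    {Y : ℝ → EuclideanSpace ℝ (Fin 3)}
    (hY : ∀ t ∈ Icc 0 T, HasDerivAt Y ((1 : ℝ) • selfSimilarTransport γ 0 V (Y t)) t)
    {ξ₀ : ℝ} (h0 : curl V (Y 0) = ξ₀ • rotGen (Y 0)) :
    ∀ t ∈ Icc 0 T, curl V (Y t) = (ξ₀ * Real.exp (-((1 + γ) * t))) • rotGen (Y t) := by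
  intro t ht
  rw [curl_comp_eq_exp_smul_rotGen_of_sigma h hax hsw hT hY h0 t ht,
    show -((1 : ℝ) * (1 + γ) * t) = -((1 + γ) * t) by ring]

/-! ### Norm forms -/

/-- **Existence of the clock datum**: `Ω(y) = ξ • J(y)` for some `ξ` (`ξ = ω_θ/r⊥` off the axis;
tree `curl_eq_hadamardQuotFst_smul_rotGen`). [cite: KochNadirashviliSereginSverak2009, §5 Remark 5.1] -/
theorem exists_curl_eq_smul_rotGen (hax : IsAxisymmetric V) (hsw : HasNoSwirl V)
    (hV : ContDiff ℝ 2 V) (y : EuclideanSpace ℝ (Fin 3)) : ∃ ξ : ℝ, curl V y = ξ • rotGen y :=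
  ⟨_, curl_eq_hadamardQuotFst_smul_rotGen hax hsw hV y⟩

/-- **Clock, norm form**: `‖Ω(Y t)‖ = |ξ₀| e^{(1+γ)t} r⊥(Y t)` along a backward orbit.
[cite: ConstantinIgnatovaVicol2026Putative, §3.4.1 eq. (3.22)] -/
theorem norm_curl_comp_eq (h : IsSelfSimilarEulerProfile γ 0 V P)
    (hax : IsAxisymmetric V) (hsw : HasNoSwirl V) {T : ℝ} (hT : 0 ≤ T)
    {Y : ℝ → EuclideanSpace ℝ (Fin 3)}
    (hY : ∀ t ∈ Icc 0 T, HasDerivAt Y ((-1 : ℝ) • selfSimilarTransport γ 0 V (Y t)) t)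
    {ξ₀ : ℝ} (h0 : curl V (Y 0) = ξ₀ • rotGen (Y 0)) :
    ∀ t ∈ Icc 0 T, ‖curl V (Y t)‖ = |ξ₀| * Real.exp ((1 + γ) * t) * cylRadius (Y t) := by
  intro t ht
  rw [curl_comp_eq_exp_smul_rotGen h hax hsw hT hY h0 t ht, norm_smul, Real.norm_eq_abs, abs_mul,
    abs_of_pos (Real.exp_pos _), norm_rotGen_eq_cylRadius']

/-- **Clock, squared form** (the input of the bathtub step of ROUND-37 (C)):
`‖Ω(Y t)‖² = ξ₀² e^{2(1+γ)t} r⊥(Y t)²`. [cite: ConstantinIgnatovaVicol2026Putative, §3.4.1 eq. (3.22)] -/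
theorem norm_curl_comp_sq_eq (h : IsSelfSimilarEulerProfile γ 0 V P)
    (hax : IsAxisymmetric V) (hsw : HasNoSwirl V) {T : ℝ} (hT : 0 ≤ T)
    {Y : ℝ → EuclideanSpace ℝ (Fin 3)}
    (hY : ∀ t ∈ Icc 0 T, HasDerivAt Y ((-1 : ℝ) • selfSimilarTransport γ 0 V (Y t)) t)
    {ξ₀ : ℝ} (h0 : curl V (Y 0) = ξ₀ • rotGen (Y 0)) :
    ∀ t ∈ Icc 0 T,
      ‖curl V (Y t)‖ ^ 2 = ξ₀ ^ 2 * Real.exp (2 * (1 + γ) * t) * cylRadius (Y t) ^ 2 := by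
  intro t ht
  rw [norm_curl_comp_eq h hax hsw hT hY h0 t ht, mul_pow, mul_pow, sq_abs, sq (Real.exp _),
    ← Real.exp_add]
  ring_nf

/-- **Clock, `ξ₀`-free cross form**: `‖Ω(Y t)‖ · r⊥(Y 0) = e^{(1+γ)t} ‖Ω(Y 0)‖ · r⊥(Y t)` along a
backward orbit on `[0, T]` — the ratio `‖Ω‖ / r⊥` grows exactly like `e^{(1+γ)t}`.
[cite: ConstantinIgnatovaVicol2026Putative, §3.4.1 eq. (3.22)] -/
theorem norm_curl_comp_mul_cylRadius_eq (h : IsSelfSimilarEulerProfile γ 0 V P)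
    (hax : IsAxisymmetric V) (hsw : HasNoSwirl V) {T : ℝ} (hT : 0 ≤ T)
    {Y : ℝ → EuclideanSpace ℝ (Fin 3)}
    (hY : ∀ t ∈ Icc 0 T, HasDerivAt Y ((-1 : ℝ) • selfSimilarTransport γ 0 V (Y t)) t) :
    ∀ t ∈ Icc 0 T,
      ‖curl V (Y t)‖ * cylRadius (Y 0) = Real.exp ((1 + γ) * t) * ‖curl V (Y 0)‖ * cylRadius (Y t) := by
  obtain ⟨ξ₀, h0⟩ := exists_curl_eq_smul_rotGen hax hsw h.contDiff_velocity (Y 0)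
  intro t ht
  rw [norm_curl_comp_eq h hax hsw hT hY h0 t ht, h0, norm_smul, Real.norm_eq_abs,
    norm_rotGen_eq_cylRadius']
  ring

/-- **On the axis the clock datum is lost, off the axis it is the ratio**: if `r⊥(Y 0) ≠ 0` then
`‖Ω(Y t)‖ = e^{(1+γ)t} (‖Ω(Y 0)‖ / r⊥(Y 0)) · r⊥(Y t)`. [cite: ConstantinIgnatovaVicol2026Putative, §3.4.1 eq. (3.22)] -/
theorem norm_curl_comp_eq_div (h : IsSelfSimilarEulerProfile γ 0 V P)
    (hax : IsAxisymmetric V) (hsw : HasNoSwirl V) {T : ℝ} (hT : 0 ≤ T)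
    {Y : ℝ → EuclideanSpace ℝ (Fin 3)}
    (hY : ∀ t ∈ Icc 0 T, HasDerivAt Y ((-1 : ℝ) • selfSimilarTransport γ 0 V (Y t)) t)
    (hY0 : cylRadius (Y 0) ≠ 0) :
    ∀ t ∈ Icc 0 T,
      ‖curl V (Y t)‖ = Real.exp ((1 + γ) * t) * (‖curl V (Y 0)‖ / cylRadius (Y 0)) * cylRadius (Y t) := by
  intro t ht
  have e := norm_curl_comp_mul_cylRadius_eq h hax hsw hT hY t ht
  field_simp
  linear_combination e

end Summit.NavierStokesRegularity.NavierStokesRegularity.Theorems.PowerGaugeEulerLiouville.NeedleCasimirClock
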